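import Summits.Ventures.HodgeRepro2.T5SU11WeightedSpaceGroundState

/-!
# The Neumann series of the resolvent on `W_1` converges uniformly on `(0, ∞)`

Row 503's exact finite Neumann identity `G^I_λ g = Σ_{k ≤ n} (μ − μ₂)^k (G^I_{λ₂})^{k+1} g + (μ − μ₂)^{n+1} G^I_λ (G^I_{λ₂})^{n+1} g`,
with the sharp `W_1` bounds of the iterates (row 557: `|(G^I_{λ₂})^{n+1} g| ≤ D Ξ/((λ₂ − 1)²)^{n+1}`) and of the resolvent
(row 556: `|G^I_λ h| ≤ D' Ξ/(λ − 1)²`), gives the remainder of the Neumann series on `W_1` explicitly: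

* `neumann_remainder_le` — **`|G^I_λ g(t) − Σ_{k ≤ n} (μ − μ₂)^k (G^I_{λ₂})^{k+1} g(t)| ≤ D Ξ(t)/(λ − 1)² · q^{n+1}`**,
  `q = |μ − μ₂|/(λ₂ − 1)²`, for every `λ, λ₂ > 1` (no smallness of `μ − μ₂` needed);
* `neumann_remainder_le'` — the same with `Ξ ≤ 1`: a `t`-uniform bound `D/(λ − 1)² · q^{n+1}`;
* `tendstoUniformlyOn_neumann` — **on the sharp disc `|μ − μ₂| < (λ₂ − 1)²` the partial sums of the Neumann series converge
  to `G^I_λ g` uniformly on `(0, ∞)`**.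

Nothing is claimed about (N).

Blind lane: Mathlib + the HodgeRepro2 prefix only; no sorry; axioms ⊆ {propext, Classical.choice,
Quot.sound}.
-/

namespace Summit.Ventures.HodgeRepro2.T5SU11ResolventNeumannUniform

open Filter Topology MeasureTheory
open Set (Ioi Ioc)
open T5SU11Cartan T5SU11SphericalFunction T5SU11SphericalDecay T5SU11SphericalBounds T5SU11RadialGreenKernel
  T5SU11RadialGreenImproper T5SU11ResolventNeumann T5SU11ResolventGroundStateWeight T5SU11WeightedSpaceGroundState

section measure

variable [MeasurableSpace Circle] [BorelSpace Circle]

variable {lam lam₂ : ℝ} (hlam : 1 < lam) (hlam₂ : 1 < lam₂) {g : ℝ → ℝ} (hg : ContinuousOn g (Ioi 0))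
  {D : ℝ} (hD : ∀ s, 0 < s → |g s| ≤ D * sph 1 (hyp s))

include hlam hlam₂ hg hD in
/-- **The remainder of the Neumann series on `W_1`**: for every `λ, λ₂ > 1`, `n` and `t > 0`,
`|G^I_λ g(t) − Σ_{k ≤ n} (μ − μ₂)^k (G^I_{λ₂})^{k+1} g(t)| ≤ D Ξ(t)/(λ − 1)² · (|μ − μ₂|/(λ₂ − 1)²)^{n+1}`. -/
theorem neumann_remainder_le (n : ℕ) {t : ℝ} (ht : 0 < t) :
    |greenSolI (fun t => sph lam (hyp t)) (sphDecay lam) g t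
        - ∑ k ∈ Finset.range (n + 1), (lam * (lam - 2) - lam₂ * (lam₂ - 2)) ^ k
            * (greenSolI (fun t => sph lam₂ (hyp t)) (sphDecay lam₂))^[k + 1] g t|
      ≤ D * sph 1 (hyp t) / (lam - 1) ^ 2
          * (|lam * (lam - 2) - lam₂ * (lam₂ - 2)| / (lam₂ - 1) ^ 2) ^ (n + 1) := by
  set κ := lam * (lam - 2) - lam₂ * (lam₂ - 2) with hκ
  have hmin : 1 < min lam lam₂ := lt_min hlam hlam₂
  obtain ⟨hM, hD0, _, C, hC⟩ := class_of_le_mul_sph_one hmin hD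
  have hε₁ : 2 - lam < (3 - min lam lam₂) / 2 := by linarith [min_le_left lam lam₂]
  have hε₂ : 2 - lam₂ < (3 - min lam lam₂) / 2 := by linarith [min_le_right lam lam₂]
  -- the exact remainder (row 503)
  have hfin := neumann_finite hlam hlam₂ hg hM hD0 hε₁ hε₂ hC n ht
  rw [← hκ] at hfin
  have hrem : greenSolI (fun t => sph lam (hyp t)) (sphDecay lam) g t
      - ∑ k ∈ Finset.range (n + 1), κ ^ k * (greenSolI (fun t => sph lam₂ (hyp t)) (sphDecay lam₂))^[k + 1] g t
      = κ ^ (n + 1) * greenSolI (fun t => sph lam (hyp t)) (sphDecay lam)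
          ((greenSolI (fun t => sph lam₂ (hyp t)) (sphDecay lam₂))^[n + 1] g) t := by
    linear_combination hfin
  rw [hrem, abs_mul, abs_pow]
  -- `(G^I_{λ₂})^{n+1} g ∈ W_1` with the constant `D/((λ₂ − 1)²)^{n+1}` (row 557), then the sharp bound at `λ` (row 556)
  obtain ⟨hc, hb⟩ := iterate_mem_weighted_one hlam₂ hg hD (n + 1)
  have hb' : ∀ s, 0 < s → |(greenSolI (fun t => sph lam₂ (hyp t)) (sphDecay lam₂))^[n + 1] g s|
      ≤ D / ((lam₂ - 1) ^ 2) ^ (n + 1) * sph 1 (hyp s) := by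
    intro s hs
    rw [div_mul_eq_mul_div]
    exact hb s hs
  have hstep := abs_greenSolI_le_mul_sph_one' hlam hc hb' ht
  calc |κ| ^ (n + 1) * |greenSolI (fun t => sph lam (hyp t)) (sphDecay lam)
          ((greenSolI (fun t => sph lam₂ (hyp t)) (sphDecay lam₂))^[n + 1] g) t|
      ≤ |κ| ^ (n + 1) * (D / ((lam₂ - 1) ^ 2) ^ (n + 1) * sph 1 (hyp t) / (lam - 1) ^ 2) :=
        mul_le_mul_of_nonneg_left hstep (pow_nonneg (abs_nonneg _) _)
    _ = D * sph 1 (hyp t) / (lam - 1) ^ 2 * (|κ| / (lam₂ - 1) ^ 2) ^ (n + 1) := by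
        rw [div_pow]
        ring

include hlam hlam₂ hg hD in
/-- The remainder of the Neumann series on `W_1`, uniformly in `t` (`Ξ ≤ 1`):
`|G^I_λ g(t) − Σ_{k ≤ n} (μ − μ₂)^k (G^I_{λ₂})^{k+1} g(t)| ≤ D/(λ − 1)² · (|μ − μ₂|/(λ₂ − 1)²)^{n+1}`. -/
theorem neumann_remainder_le' (n : ℕ) {t : ℝ} (ht : 0 < t) :
    |greenSolI (fun t => sph lam (hyp t)) (sphDecay lam) g t
        - ∑ k ∈ Finset.range (n + 1), (lam * (lam - 2) - lam₂ * (lam₂ - 2)) ^ k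
            * (greenSolI (fun t => sph lam₂ (hyp t)) (sphDecay lam₂))^[k + 1] g t|
      ≤ D / (lam - 1) ^ 2 * (|lam * (lam - 2) - lam₂ * (lam₂ - 2)| / (lam₂ - 1) ^ 2) ^ (n + 1) := by
  have hD0 : 0 ≤ D := (class_of_le_mul_sph_one hlam hD).2.1
  have hL : 0 < (lam - 1) ^ 2 := by
    have : 0 < lam - 1 := by linarith
    positivity
  have hr : 0 < (lam₂ - 1) ^ 2 := by
    have : 0 < lam₂ - 1 := by linarith
    positivity
  refine (neumann_remainder_le hlam hlam₂ hg hD n ht).trans ?_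
  apply mul_le_mul_of_nonneg_right _ (pow_nonneg (div_nonneg (abs_nonneg _) hr.le) _)
  apply div_le_div_of_nonneg_right _ hL.le
  exact mul_le_of_le_one_right hD0 (sph_hyp_le_one zero_le_one one_le_two t)

include hlam hlam₂ hg hD in
/-- **THE NEUMANN SERIES CONVERGES UNIFORMLY ON `(0, ∞)`**: for `|μ − μ₂| < (λ₂ − 1)²` and `g ∈ W_1`, the partial sums
`Σ_{k < n} (μ − μ₂)^k (G^I_{λ₂})^{k+1} g` converge to `G^I_λ g` uniformly on `(0, ∞)`. -/
theorem tendstoUniformlyOn_neumann (hq : |lam * (lam - 2) - lam₂ * (lam₂ - 2)| < (lam₂ - 1) ^ 2) :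
    TendstoUniformlyOn
      (fun n t => ∑ k ∈ Finset.range n, (lam * (lam - 2) - lam₂ * (lam₂ - 2)) ^ k
        * (greenSolI (fun t => sph lam₂ (hyp t)) (sphDecay lam₂))^[k + 1] g t)
      (greenSolI (fun t => sph lam (hyp t)) (sphDecay lam) g) atTop (Ioi 0) := by
  rw [Metric.tendstoUniformlyOn_iff]
  intro ε hε
  have hr : 0 < (lam₂ - 1) ^ 2 := by
    have : 0 < lam₂ - 1 := by linarith
    positivity
  set q := |lam * (lam - 2) - lam₂ * (lam₂ - 2)| / (lam₂ - 1) ^ 2 with hqdef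
  have hq0 : 0 ≤ q := div_nonneg (abs_nonneg _) hr.le
  have hq1 : q < 1 := (div_lt_one hr).mpr hq
  have htend : Tendsto (fun n : ℕ => D / (lam - 1) ^ 2 * q ^ n) atTop (𝓝 0) := by
    simpa using (tendsto_pow_atTop_nhds_zero_of_lt_one hq0 hq1).const_mul (D / (lam - 1) ^ 2)
  have hev : ∀ᶠ n : ℕ in atTop, D / (lam - 1) ^ 2 * q ^ n < ε := (tendsto_order.1 htend).2 ε hε
  filter_upwards [hev, eventually_ge_atTop 1] with n hn hn1
  intro t ht
  obtain ⟨m, rfl⟩ : ∃ m, n = m + 1 := ⟨n - 1, by omega⟩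
  rw [Real.dist_eq]
  exact (neumann_remainder_le' hlam hlam₂ hg hD m ht).trans_lt hn

end measure

end Summit.Ventures.HodgeRepro2.T5SU11ResolventNeumannUniform
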